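import Summits.QuantumFields.YangMills.Theorems.AtomicCalibrationRMirrorCalibrationOnset
import HarnessLib

/-!
# B6 `stub_mirrorCalibration` of LINE «MirrorCalibration» on crux ⟨stmt-QuantumFields-28169⟩ — part 2/2:
# `OnsetFloors → SubOnsetTwoPointCeilings → MirrorCalibratedUnit` BY NAME

Author of the mathematics and of the Lean proof: planner **ym-idea-11 g15** (HOME `ideators/ym-idea-11/g15/bc/mc_b6.lean`,
sha aced21bb, verified by idea-crit-9 ACK #86b); landed unchanged (split at the 400-line cap, §0/§1b currency defs replaced by the
import of `Theorems/AtomicCalibrationRMirrorCalibrationDefs.lean` = critic price #86 P2) by the LEAD seat ym-line-sfw-p2 g74 as a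
landing service.

Content of part 2 (§S and the assembly of the source): `rpSquare_le_of_pairBound` (`rpSquare ≤ #S²·Mb²·m` from a
pair bound), the two regimes `rpSquare_le_coarse` (`s > δ/8`) and `rpSquare_le_fine` (`K·aβ < s ≤ δ/8`,
`R = ⌊δ/s⌋₊ − 3`, the `R⁻⁸` decay of the two-point ceiling against the `s⁻⁸` pair count), and
**`stub_mirrorCalibration`** (= `mirrorCalibration_proof`): the calibrated unit `a' := K·a` with onset domination and
`LowerBounds G r a'` with dilated tests (`UVSeamRec.UnitDilation.lowerBounds_const_mul_iff`).

HONEST LABEL: calibration/bookkeeping under OPEN wall-class hypotheses (`OnsetFloors` 25892, `SubOnsetTwoPointCeilings`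
26671); nothing here proves NT, a β-uniform bound, the leaf 19868, any crux, rung or summit; the Yang–Mills mass gap is
NOT proved.
-/

set_option autoImplicit false

noncomputable section

open scoped BigOperators
open MeasureTheory Filter Topology
open Literature.MathematicalPhysics.QuantumFieldTheory Literature.MathematicalPhysics.QuantumLattice
open Literature.Probability.LatticeModels (Site)
open Summit.QuantumFields.YangMills.Theorems.InfiniteVolume (stateMomentStr measurable_plane
  abs_integral_centred_prod_le_of_eventually eventually_torusSeparated eventually_le_of_strictMono)
open Summit.QuantumFields.YangMills.Theorems.InfVolRP (centreOffset centreOffset_time norm_centreOffset_le_one)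
open Summit.QuantumFields.YangMills.Theorems.OnsetTautologyOnsetContraction (stateMomentStr_two abs_centredPlane_le
  abs_coord_le_of_ne_zero)
open Summit.QuantumFields.YangMills.Theses.OnsetTautology (AdmissibleAtomProfile)
open Summit.QuantumFields.YangMills.Cruxes.OSLegsFromFemtoAndGap.DlrCollarTransfer

namespace Summit.QuantumFields.YangMills.Cruxes.AtomicCalibrationR.MirrorCalibration

variable {G : Type} [Group G] [TopologicalSpace G] [IsTopologicalGroup G] [CompactSpace G]
  [MeasurableSpace G] [BorelSpace G]

/-! ## §S The reflection-positivity square through a pair bound -/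

omit [IsTopologicalGroup G] [CompactSpace G] [BorelSpace G] in
/-- If both atoms live on `S`, `|b| ≤ Mb`, and every (reflected-atom plaquette, atom plaquette) pair has centred
two-point weight of modulus `≤ m`, then `rpSquare ≤ #S² · Mb² · m`. -/
theorem rpSquare_le_of_pairBound (r : LatticeRep G) (μ : Measure (LGConfig 4 G))
    (b : SchwartzMap (EuclideanSpace ℝ (Fin 4)) ℝ) (q : Fin 4 × Fin 4) (s : ℝ) (y : EuclideanSpace ℝ (Fin 4))
    (S : Finset ((Fin 4 × Fin 4) × (Fin 4 → ℤ)))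
    (hSt : ∀ p, atomWt b {q} s y p ≠ 0 → p ∈ S) (hSr : ∀ p, atomWr b {q} s y p ≠ 0 → p ∈ S)
    {Mb : ℝ} (hMb : ∀ u, |b u| ≤ Mb) {m : ℝ} (hm : 0 ≤ m)
    (hpair : ∀ p p' : (Fin 4 × Fin 4) × (Fin 4 → ℤ), atomWr b {q} s y p ≠ 0 → atomWt b {q} s y p' ≠ 0 →
      |stateMomentStr G r μ 2 ![p.1, p'.1] ![p.2, p'.2]| ≤ m) :
    rpSquare r μ b {q} s y ≤ (S.card : ℝ) ^ 2 * Mb ^ 2 * m := by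
  have hMb0 : 0 ≤ Mb := (abs_nonneg _).trans (hMb 0)
  unfold rpSquare
  rw [tsum_eq_sum (s := S ×ˢ S) (fun pp hpp => by
    rw [Finset.mem_product, not_and_or] at hpp
    rcases hpp with h | h
    · have h0 : atomWr b {q} s y pp.1 = 0 := by
        by_contra hne
        exact h (hSr _ hne)
      rw [h0, zero_mul, zero_mul]
    · have h0 : atomWt b {q} s y pp.2 = 0 := by
        by_contra hne
        exact h (hSt _ hne)
      rw [h0, mul_zero, zero_mul])]
  have hterm : ∀ pp ∈ S ×ˢ S, atomWr b {q} s y pp.1 * atomWt b {q} s y pp.2 *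
      stateMomentStr G r μ 2 ![pp.1.1, pp.2.1] ![pp.1.2, pp.2.2] ≤ Mb * Mb * m := by
    intro pp _
    refine (le_abs_self _).trans ?_
    by_cases h1 : atomWr b {q} s y pp.1 = 0
    · rw [h1, zero_mul, zero_mul, abs_zero]; positivity
    by_cases h2 : atomWt b {q} s y pp.2 = 0
    · rw [h2, mul_zero, zero_mul, abs_zero]; positivity
    rw [abs_mul, abs_mul]
    exact mul_le_mul (mul_le_mul (abs_atomWr_le hMb _ _ _ _) (abs_atomWt_le hMb _ _ _ _) (abs_nonneg _) hMb0)
      (hpair pp.1 pp.2 h1 h2) (abs_nonneg _) (mul_nonneg hMb0 hMb0)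
  calc ∑ pp ∈ S ×ˢ S, atomWr b {q} s y pp.1 * atomWt b {q} s y pp.2 *
          stateMomentStr G r μ 2 ![pp.1.1, pp.2.1] ![pp.1.2, pp.2.2]
        ≤ ∑ _pp ∈ S ×ˢ S, Mb * Mb * m := Finset.sum_le_sum hterm
    _ = (S.card : ℝ) ^ 2 * Mb ^ 2 * m := by
        rw [Finset.sum_const, Finset.card_product, nsmul_eq_mul]; push_cast; ring


/-! ## §D The two atom-scale regimes of the domination -/

omit [IsTopologicalGroup G] [CompactSpace G] [BorelSpace G] in
/-- COARSE REGIME `s > δ/8`: the carrier has at most `(2B₁+1)⁴` plaquettes, `B₁ = ⌈8t/δ⌉₊ + 3`, and every pair is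
bounded by `(2Cp)²`. -/
theorem rpSquare_le_coarse (r : LatticeRep G) (μ : Measure (LGConfig 4 G)) [IsProbabilityMeasure μ]
    {b : SchwartzMap (EuclideanSpace ℝ (Fin 4)) ℝ} {t δ Mb Cp : ℝ}
    (hbt : Function.support (b : EuclideanSpace ℝ (Fin 4) → ℝ) ⊆ Metric.closedBall 0 t) (ht0 : 0 < t)
    (hδpos : 0 < δ) (hMb : ∀ u, |b u| ≤ Mb)
    (hCp : ∀ (q : Fin 4 × Fin 4) (x : Fin 4 → ℤ) (U : LGConfig 4 G), |plane G r q x U| ≤ Cp)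
    {s : ℝ} (hs0 : 0 < s) (hreg : δ / 8 < s) {y : EuclideanSpace ℝ (Fin 4)} (hy : ∀ i, 0 ≤ y i ∧ y i ≤ s)
    (q : Fin 4 × Fin 4) :
    rpSquare r μ b {q} s y ≤ ((2 * ((⌈8 * t / δ⌉₊ + 3 : ℕ) : ℝ) + 1) ^ 4) ^ 2 * Mb ^ 2 * (2 * Cp) ^ 2 := by
  have hB : t / s + 3 ≤ ((⌈t / s⌉₊ + 3 : ℕ) : ℝ) := by push_cast; linarith [Nat.le_ceil (t / s)]
  have hcar := atom_subset_carrier hbt hs0 hy q hB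
  have hts : t / s ≤ 8 * t / δ := by
    rw [div_le_iff₀ hs0, div_mul_eq_mul_div, le_div_iff₀ hδpos]
    nlinarith [mul_pos ht0 (show (0 : ℝ) < 8 * s - δ by linarith)]
  have hBB₁ : ⌈t / s⌉₊ + 3 ≤ ⌈8 * t / δ⌉₊ + 3 := Nat.add_le_add_right (Nat.ceil_mono hts) 3
  have hbound := rpSquare_le_of_pairBound r μ b q s y (carrier q (⌈t / s⌉₊ + 3)) (fun p hp => (hcar p).1 hp)
    (fun p hp => (hcar p).2 hp) hMb (by positivity : (0 : ℝ) ≤ (2 * Cp) ^ 2)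
    (fun p p' _ _ => abs_stateMomentStr_two_le r μ hCp _ _ _ _)
  rw [card_carrier] at hbound
  push_cast at hbound
  have h1 : (2 * ((⌈t / s⌉₊ : ℝ) + 3) + 1) ^ 4 ≤ (2 * ((⌈8 * t / δ⌉₊ : ℝ) + 3) + 1) ^ 4 := by
    have : ((⌈t / s⌉₊ + 3 : ℕ) : ℝ) ≤ ((⌈8 * t / δ⌉₊ + 3 : ℕ) : ℝ) := by exact_mod_cast hBB₁
    push_cast at this
    exact pow_le_pow_left₀ (by positivity) (by linarith) 4
  calc rpSquare r μ b {q} s y ≤ ((2 * ((⌈t / s⌉₊ : ℝ) + 3) + 1) ^ 4) ^ 2 * Mb ^ 2 * (2 * Cp) ^ 2 := hbound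
    _ ≤ ((2 * ((⌈8 * t / δ⌉₊ : ℝ) + 3) + 1) ^ 4) ^ 2 * Mb ^ 2 * (2 * Cp) ^ 2 := by gcongr
    _ = ((2 * ((⌈8 * t / δ⌉₊ + 3 : ℕ) : ℝ) + 1) ^ 4) ^ 2 * Mb ^ 2 * (2 * Cp) ^ 2 := by push_cast; ring

omit [IsTopologicalGroup G] [CompactSpace G] [BorelSpace G] in
/-- FINE REGIME `K α < s ≤ δ/8` (α = the unit at this β, `K ≥ δ/ℓ₄`): with `R = ⌊δ/s⌋₊ − 3` every (reflected,
direct) pair is `(2R+4)`-separated in time, `1 ≤ R`, `R α ≤ ℓ₄`, so each pair is bounded by the inherited ceiling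
`(C/R⁴)²`; the `s⁻⁸` pair count is compensated by the `R⁻⁸` decay: `rpSquare ≤ Mb² C² (4(t+δ)/δ)⁸`. -/
theorem rpSquare_le_fine (r : LatticeRep G) (μ : Measure (LGConfig 4 G))
    {b : SchwartzMap (EuclideanSpace ℝ (Fin 4)) ℝ} {t δ Mb C ℓ₄ α K : ℝ}
    (hbt : Function.support (b : EuclideanSpace ℝ (Fin 4) → ℝ) ⊆ Metric.closedBall 0 t) (ht0 : 0 < t)
    (hδpos : 0 < δ) (hδ : ∀ u, b u ≠ 0 → δ ≤ u 0) (hMb : ∀ u, |b u| ≤ Mb)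
    (hα : 0 < α) (hℓ₄ : 0 < ℓ₄) (hKpos : 0 < K) (hKδ : δ / ℓ₄ ≤ K)
    (hceilμ : ∀ (R : ℕ), 1 ≤ R → (R : ℝ) * α ≤ ℓ₄ → ∀ (q q' : Fin 4 × Fin 4) (x y : Fin 4 → ℤ),
      q.1 < q.2 → q'.1 < q'.2 → (∃ k : Fin 4, (2 * (R : ℤ) + 4) ≤ |x k - y k|) →
      |stateMomentStr G r μ 2 ![q, q'] ![x, y]| ≤ (C / (R : ℝ) ^ 4) ^ 2)
    {s : ℝ} (hs0 : 0 < s) (hreg : s ≤ δ / 8) (hlt : K * α < s) {y : EuclideanSpace ℝ (Fin 4)}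
    (hy : ∀ i, 0 ≤ y i ∧ y i ≤ s) (q : Fin 4 × Fin 4) :
    rpSquare r μ b {q} s y ≤ Mb ^ 2 * (C ^ 2 * (4 * (t + δ) / δ) ^ 8) := by
  have hs0' : s ≠ 0 := hs0.ne'
  have hδ0 : δ ≠ 0 := hδpos.ne'
  have hB : t / s + 3 ≤ ((⌈t / s⌉₊ + 3 : ℕ) : ℝ) := by push_cast; linarith [Nat.le_ceil (t / s)]
  have hcar := atom_subset_carrier hbt hs0 hy q hB
  -- the separation radius `R = ⌊δ/s⌋₊ − 3`
  have h8 : (8 : ℝ) ≤ δ / s := by rw [le_div_iff₀ hs0]; linarith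
  have hm8 : 8 ≤ ⌊δ / s⌋₊ := Nat.le_floor (by exact_mod_cast h8)
  have hfl : (⌊δ / s⌋₊ : ℝ) ≤ δ / s := Nat.floor_le (by positivity)
  obtain ⟨R, hR1, hRle, hRge⟩ : ∃ R : ℕ, 1 ≤ R ∧ (R : ℝ) ≤ δ / s - 3 ∧ δ / s - 4 ≤ (R : ℝ) := by
    refine ⟨⌊δ / s⌋₊ - 3, by omega, ?_, ?_⟩
    · rw [Nat.cast_sub (by omega)]; push_cast; linarith
    · rw [Nat.cast_sub (by omega)]; push_cast; linarith [Nat.lt_floor_add_one (δ / s)]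
  have hRlow : δ / (2 * s) ≤ (R : ℝ) := by
    have : δ / (2 * s) = (δ / s) / 2 := by rw [div_div, mul_comm]
    rw [this]; linarith
  -- `R · α ≤ ℓ₄`
  have hRa : (R : ℝ) * α ≤ ℓ₄ := by
    have h1 : (R : ℝ) * α ≤ δ / s * α := mul_le_mul_of_nonneg_right (by linarith) hα.le
    have h2 : δ / s * α ≤ δ / K := by
      have : δ / s * α = (δ / K) * ((K * α) / s) := by field_simp
      rw [this]
      exact mul_le_of_le_one_right (by positivity) ((div_le_one hs0).2 hlt.le)
    have h3 : δ / K ≤ ℓ₄ := by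
      rw [div_le_iff₀ hKpos]
      have := hKδ; rw [div_le_iff₀ hℓ₄] at this; linarith
    linarith
  -- the pair bound: (reflected plaquette, direct plaquette) pairs are `(2R+4)`-separated in time
  have hpair : ∀ p p' : (Fin 4 × Fin 4) × (Fin 4 → ℤ), atomWr b {q} s y p ≠ 0 → atomWt b {q} s y p' ≠ 0 →
      |stateMomentStr G r μ 2 ![p.1, p'.1] ![p.2, p'.2]| ≤ (C / (R : ℝ) ^ 4) ^ 2 := by
    intro p p' hp hp'
    have hq1 := (atomWr_ne_zero_iff b {q} s y p).1 hp
    have hq2 := (atomWt_ne_zero_iff b {q} s y p').1 hp'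
    refine hceilμ R hR1 hRa p.1 p'.1 p.2 p'.2 hq1.1.2 hq2.1.2 ⟨0, ?_⟩
    have hlo := time_floor_of_wt hδ hs0 (hy 0).1 p'.1 p'.2 hq2.2
    have hhi := time_ceiling_of_wr hδ hs0 (hy 0).1 p.1 p.2 hq1.2
    have hreal : (2 * (R : ℝ) + 4) ≤ ((p'.2 0 : ℤ) : ℝ) - ((p.2 0 : ℤ) : ℝ) := by linarith
    have hint : (2 * (R : ℤ) + 4) ≤ p'.2 0 - p.2 0 := by exact_mod_cast hreal
    rw [abs_sub_comm]
    exact hint.trans (le_abs_self _)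
  have hbound := rpSquare_le_of_pairBound r μ b q s y (carrier q (⌈t / s⌉₊ + 3)) (fun p hp => (hcar p).1 hp)
    (fun p hp => (hcar p).2 hp) hMb (by positivity) hpair
  rw [card_carrier] at hbound
  push_cast at hbound
  -- `#S ≤ ((2t+2δ)/s)⁴` and `(C/R⁴)² ≤ C² (2s/δ)⁸`
  have hcardR : (2 * ((⌈t / s⌉₊ : ℝ) + 3) + 1) ^ 4 ≤ ((2 * t + 2 * δ) / s) ^ 4 := by
    have hB' : (⌈t / s⌉₊ : ℝ) < t / s + 1 := Nat.ceil_lt_add_one (by positivity)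
    have h9 : (9 : ℝ) ≤ 2 * δ / s := by rw [le_div_iff₀ hs0]; linarith
    have hsum : (2 * t + 2 * δ) / s = 2 * (t / s) + 2 * δ / s := by ring
    exact pow_le_pow_left₀ (by positivity) (by rw [hsum]; linarith) 4
  have hdecay : (C / (R : ℝ) ^ 4) ^ 2 ≤ C ^ 2 * (2 * s / δ) ^ 8 := by
    have hRpos : (0 : ℝ) < R := by exact_mod_cast hR1
    have h1 : (C / (R : ℝ) ^ 4) ^ 2 = C ^ 2 / (R : ℝ) ^ 8 := by rw [div_pow, ← pow_mul]
    have h2 : (δ / (2 * s)) ^ 8 ≤ (R : ℝ) ^ 8 := pow_le_pow_left₀ (by positivity) hRlow 8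
    have h3 : C ^ 2 / (R : ℝ) ^ 8 ≤ C ^ 2 / (δ / (2 * s)) ^ 8 :=
      div_le_div_of_nonneg_left (sq_nonneg C) (by positivity) h2
    have h4 : C ^ 2 / (δ / (2 * s)) ^ 8 = C ^ 2 * (2 * s / δ) ^ 8 := by
      rw [← inv_div (2 * s) δ, inv_pow, div_inv_eq_mul]
    calc (C / (R : ℝ) ^ 4) ^ 2 = C ^ 2 / (R : ℝ) ^ 8 := h1
      _ ≤ C ^ 2 / (δ / (2 * s)) ^ 8 := h3
      _ = C ^ 2 * (2 * s / δ) ^ 8 := h4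
  have hprod : (((2 * t + 2 * δ) / s) ^ 4) ^ 2 * (2 * s / δ) ^ 8 = (4 * (t + δ) / δ) ^ 8 := by
    rw [← pow_mul, show 4 * 2 = 8 by norm_num, ← mul_pow]
    congr 1
    field_simp
    ring
  calc rpSquare r μ b {q} s y ≤ ((2 * ((⌈t / s⌉₊ : ℝ) + 3) + 1) ^ 4) ^ 2 * Mb ^ 2 * (C / (R : ℝ) ^ 4) ^ 2 := hbound
    _ ≤ (((2 * t + 2 * δ) / s) ^ 4) ^ 2 * Mb ^ 2 * (C ^ 2 * (2 * s / δ) ^ 8) := by gcongr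
    _ = Mb ^ 2 * (C ^ 2 * ((((2 * t + 2 * δ) / s) ^ 4) ^ 2 * (2 * s / δ) ^ 8)) := by ring
    _ = Mb ^ 2 * (C ^ 2 * (4 * (t + δ) / δ) ^ 8) := by rw [hprod]

/-! ## §M The stub B6: `OnsetFloors → SubOnsetTwoPointCeilings → MirrorCalibratedUnit` -/

/-- **B6 `stub_mirrorCalibration` — PROVED.**  Level `ε := min ε₁ ε₀`; the unit `a` of the rung; the sub-onset
two-point ceiling applied AT the unit (every resolution `≥ 2 a β` is above the joint onset); inheritance of the
`(C/R⁴)²` ceiling by the limit states; the admissible profile `b` of item 23903; atom geometry (carrier box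
`t_b/s + 3`, time floor `δ_b/s − 1`, mirror ceiling `−δ_b/s`); two atom-scale regimes (`s > δ_b/8`: bounded
carrier; `K a β < s ≤ δ_b/8`: time separation `2R+4`, `R = ⌊δ_b/s⌋ − 3`, the `R⁻⁸` decay compensating the
`s⁻⁸` pair count); the dilated unit `K · a` carries the floors by exact dilation covariance. -/
theorem mirrorCalibration_proof
    (hF : Summit.QuantumFields.YangMills.Theses.OnsetCalibration.OnsetFloors)
    (hT : Summit.QuantumFields.YangMills.Theses.SquareRootCeilings.SubOnsetTwoPointCeilings) :
    MirrorCalibratedUnit := by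
  intro G _ _ _ _ hG hcl
  letI : MeasurableSpace G := borel G
  haveI : BorelSpace G := ⟨rfl⟩
  -- §1 datum, level, unit
  obtain ⟨r, v, f, g, h, ε₁, Λ₅, β₅, hv, hfg, hgh, hfh, hε₁, hfloor, hunit⟩ :=
    jointOnsetUnit_of_onsetFloors_level hF G hG hcl
  obtain ⟨ε₀, hε₀, hT'⟩ := hT G hG hcl r v f g h Λ₅
  have hεpos : 0 < min ε₁ ε₀ := lt_min hε₁ hε₀
  obtain ⟨a, ha_pos, ha_le, ha0, hlb, hcal⟩ := hunit (min ε₁ ε₀) hεpos (min_le_left _ _)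
  obtain ⟨C, ℓ₄, β₄, hℓ₄, hC, hceil⟩ := hT' (min ε₁ ε₀) hεpos (min_le_right _ _)
    ⟨β₅, fun β hβ => ⟨a β, ha_pos β, ha_le β, (hcal β hβ).1.1, (hcal β hβ).1.2⟩⟩
  -- §2 the torus two-point ceiling AT THE UNIT, from `β₈ := max β₄ β₅` on
  have hceilU : ∀ β : ℝ, max β₄ β₅ ≤ β → ∀ (R : ℕ), 1 ≤ R → (R : ℝ) * a β ≤ ℓ₄ →
      ∀ (L : ℕ) (q q' : Fin 4 × Fin 4) (x y : Fin 4 → ℤ), q.1 < q.2 → q'.1 < q'.2 → 4 * R + 8 ≤ L →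
      (∃ k : Fin 4, (2 * (R : ℤ) + 4) ≤ |((((x k - y k : ℤ) : ZMod (2 * L + 1))).valMinAbs : ℤ)|) →
      |torusE G r β L (fun U => (plane G r q x U - torusE G r β L (plane G r q x)) *
        (plane G r q' y U - torusE G r β L (plane G r q' y)))| ≤ (C / (R : ℝ) ^ 4) ^ 2 := by
    intro β hβ R hR hRa L q q' x y hq hq' hL hsep
    have hβ4 : β₄ ≤ β := le_trans (le_max_left _ _) hβ
    have hβ5 : β₅ ≤ β := le_trans (le_max_right _ _) hβ
    refine hceil β hβ4 (a β) (ha_pos β) (ha_le β) (fun s' h2s hs1 hfl => ?_) L q q' x y R hq hq' hR hRa hL hsep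
    have := (hcal β hβ5).2 s' (by linarith [ha_pos β]) hs1 hfl.1 hfl.2
    linarith
  -- §3 inheritance by the limit states
  have hceilμ : ∀ β : ℝ, max β₄ β₅ ≤ β → ∀ μ ∈ oddTorusLimitPoints r β, ∀ (R : ℕ), 1 ≤ R →
      (R : ℝ) * a β ≤ ℓ₄ → ∀ (q q' : Fin 4 × Fin 4) (x y : Fin 4 → ℤ), q.1 < q.2 → q'.1 < q'.2 →
      (∃ k : Fin 4, (2 * (R : ℤ) + 4) ≤ |x k - y k|) →
      |stateMomentStr G r μ 2 ![q, q'] ![x, y]| ≤ (C / (R : ℝ) ^ 4) ^ 2 :=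
    fun β hβ μ hμ R hR hRa q q' x y hq hq' hsep =>
      twoPoint_limitState r (hceilU β hβ R hR hRa) hμ q q' x y hq hq' hsep
  -- §4 the admissible profile and its constants `t` (support radius), `δ` (time floor), `Mb` (sup), `Cp`
  obtain ⟨b, hbc, hbsupp, hbint, hperm, htime⟩ :=
    Summit.QuantumFields.YangMills.Theorems.OnsetTautology.admissibleAtomProfile_proof
  obtain ⟨t, ht0, hbt'⟩ := hbc.isCompact.isBounded.subset_closedBall_lt 0 (0 : EuclideanSpace ℝ (Fin 4))
  have hbt : Function.support (b : EuclideanSpace ℝ (Fin 4) → ℝ) ⊆ Metric.closedBall 0 t :=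
    (subset_tsupport _).trans hbt'
  have hne : (tsupport (b : EuclideanSpace ℝ (Fin 4) → ℝ)).Nonempty := by
    by_contra hemp
    rw [Set.not_nonempty_iff_eq_empty, tsupport_eq_empty_iff] at hemp
    exact hbint (by simp [hemp])
  have hcont : Continuous fun u : EuclideanSpace ℝ (Fin 4) => u 0 :=
    PiLp.continuous_apply (p := 2) (β := fun _ : Fin 4 => ℝ) 0
  obtain ⟨u₀, hu₀mem, hu₀min⟩ := hbc.isCompact.exists_isMinOn hne hcont.continuousOn
  obtain ⟨δ, hδpos, hδ⟩ : ∃ δ : ℝ, 0 < δ ∧ ∀ u, b u ≠ 0 → δ ≤ u 0 :=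
    ⟨u₀ 0, hbsupp hu₀mem, fun u hu => (isMinOn_iff.1 hu₀min) u (subset_tsupport _ (Function.mem_support.2 hu))⟩
  obtain ⟨Mb, hMb⟩ : ∃ Mb : ℝ, ∀ u, |b u| ≤ Mb := ⟨SchwartzMap.seminorm ℝ 0 0 b, fun u => by
    have := SchwartzMap.norm_le_seminorm ℝ b u
    rwa [Real.norm_eq_abs] at this⟩
  obtain ⟨Cp, hCp⟩ := exists_abs_plane_le (G := G) r
  -- §5 the constants of the domination: dilation `K ≥ max 1 (δ/ℓ₄)`, level `E` above both regime bounds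
  obtain ⟨K, hK1, hKδ⟩ : ∃ K : ℝ, 1 ≤ K ∧ δ / ℓ₄ ≤ K := ⟨max 1 (δ / ℓ₄), le_max_left _ _, le_max_right _ _⟩
  have hKpos : 0 < K := lt_of_lt_of_le one_pos hK1
  obtain ⟨E, hEpos, hEc, hEf⟩ : ∃ E : ℝ, 0 < E ∧
      ((2 * ((⌈8 * t / δ⌉₊ + 3 : ℕ) : ℝ) + 1) ^ 4) ^ 2 * Mb ^ 2 * (2 * Cp) ^ 2 < E ∧
      Mb ^ 2 * (C ^ 2 * (4 * (t + δ) / δ) ^ 8) < E := by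
    have h1 : 0 ≤ ((2 * ((⌈8 * t / δ⌉₊ + 3 : ℕ) : ℝ) + 1) ^ 4) ^ 2 * Mb ^ 2 * (2 * Cp) ^ 2 := by positivity
    have h2 : 0 ≤ Mb ^ 2 * (C ^ 2 * (4 * (t + δ) / δ) ^ 8) := by positivity
    refine ⟨((2 * ((⌈8 * t / δ⌉₊ + 3 : ℕ) : ℝ) + 1) ^ 4) ^ 2 * Mb ^ 2 * (2 * Cp) ^ 2 +
      Mb ^ 2 * (C ^ 2 * (4 * (t + δ) / δ) ^ 8) + 1, ?_, ?_, ?_⟩ <;> linarith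
  -- §6 ONSET DOMINATION below the dilated unit `K · a β`
  have hdom : ∀ β : ℝ, max β₄ β₅ ≤ β → ∀ μ ∈ oddTorusLimitPoints r β, ∀ s ∈ onsetSet r μ b E, s ≤ K * a β := by
    intro β hβ μ hμ s hs
    refine not_lt.1 fun hlt => ?_
    obtain ⟨hs0, q, y, hy, hEle⟩ := hs
    haveI : IsProbabilityMeasure μ := by
      have hμ' := hμ
      obtain ⟨S₀, -, hp, -⟩ := hμ'
      exact hp
    by_cases hreg : δ / 8 < s
    · have := rpSquare_le_coarse r μ hbt ht0 hδpos hMb hCp hs0 hreg hy q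
      linarith only [this, hEle, hEc]
    · have := rpSquare_le_fine r μ hbt ht0 hδpos hδ hMb (ha_pos β) hℓ₄ hKpos hKδ (hceilμ β hβ μ hμ) hs0
        (not_lt.1 hreg) hlt hy q
      linarith only [this, hEle, hEf]
  -- §7 the dilated unit `a' := K · a`
  have hev : ∀ᶠ β in atTop, a β ≤ 1 / K := ha0.eventually (eventually_le_nhds (by positivity))
  obtain ⟨β₀, hβ₀⟩ := Filter.eventually_atTop.1 hev
  refine ⟨r, fun β => K * a β, b, E, ⟨hbc, hbsupp, hbint, hperm, htime⟩, hEpos,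
    fun β => mul_pos hKpos (ha_pos β), ?_, ?_, ⟨max (max β₄ β₅) β₀, fun β hβ => ⟨?_, fun μ hμ s hs =>
      hdom β (le_trans (le_max_left _ _) hβ) μ hμ s hs⟩⟩⟩
  · simpa using ha0.const_mul K
  · exact (Summit.QuantumFields.YangMills.Cruxes.UVSeamRec.UnitDilation.lowerBounds_const_mul_iff r a hKpos).2 hlb
  · have := hβ₀ β (le_trans (le_max_right _ _) hβ)
    rw [le_div_iff₀ hKpos] at this
    linarith

/-- ★ **Registered stub B6 BY NAME + SIGNATURE** (skeleton `g15/mirror-calibration.lean` of planner ym-idea-11 on crux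
⟨stmt-QuantumFields-28169⟩): the mirror-calibrated unit from the shared residuals. -/
theorem stub_mirrorCalibration :
    Summit.QuantumFields.YangMills.Theses.OnsetCalibration.OnsetFloors →
    Summit.QuantumFields.YangMills.Theses.SquareRootCeilings.SubOnsetTwoPointCeilings → MirrorCalibratedUnit :=
  mirrorCalibration_proof

end Summit.QuantumFields.YangMills.Cruxes.AtomicCalibrationR.MirrorCalibration

end
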